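import Mathlib
import HarnessLib
import Summits.Langlands.Langlands.Theses.G2ShadowRankSeven
import Literature.NumberTheory.GaloisRepresentations.AdZeroBlochKatoDatum
import Literature.NumberTheory.GaloisRepresentations.CompatibleSystemResidualIrreducibility
import Literature.NumberTheory.Automorphic.IsobaricRigidityRepData

/-!
# Sketch — first lemmas of the crux ideas for `LineOrIrreducibleAdmissible`
(route `G2ShadowRankSeven`, item stmt-Langlands-18289; crux-ideate round 1, ideator k = 2)

Two typed first lemmas, one per idea card:

* `TensorCellIsobaricOverQ` (card `a1-cells-automorphic-over-q`): in the SO₄-cell of the G₂ branch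
  a compatible semisimple avatar has the tensor shape `ρ ≃ (r₁ ⊗ r₂) ⊕ (ad⁰ r₂ ⊗ ψ)` with
  `r₁ r₂ : Γ_ℚ → GL₂`; 2-dimensional reciprocity over `ℚ` in both parities + the known
  `GL₂`-functorialities put every constituent on some `GL_{m_i}/ℚ`, i.e. the Satake parameters of
  `π` are eventually a sum of Satake parameters of `k ≥ 2` cuspidals — the negated hypothesis shape
  of the in-tree `CuspidalAutomorphicRepData.not_eventually_satake_eq_sum_of_JS`.
* `TwoSystemsVsIrreduciblePlace` (card `double-extension-g2-place`): if BOTH pieces of a `4 + 3`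
  splitting of a compatible avatar are members of weakly compatible systems of `Γ_ℚ`, then `π`
  has no irreducible compatible avatar at any place — contradicting the G₂ place itself.
-/

namespace Summit.Langlands.Langlands.Cruxes.LineOrIrreducibleAdmissible.Ideas

open Literature.NumberTheory.Automorphic Literature.NumberTheory.GaloisRepresentations
open IsDedekindDomain NumberField Field
open scoped NumberField Matrix

/-- First lemma of card `a1-cells-automorphic-over-q` ("the tensor cell is isobaric over ℚ").
For a cuspidal `π` on `GL₇/ℚ` with regular L-algebraic infinity type, essentially self-dual at
Satake level, there is a finite exceptional set of primes off which: whenever a Satake–Frobenius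
compatible framed `ρ : Γ_ℚ → GL₇(ℚ̄_ℓ)` has the characteristic polynomials of a TENSOR CELL
`(r₁ ⊗ r₂) ⊕ (ad⁰ r₂ ⊗ ψ)` (`r₁ r₂ : Γ_ℚ → GL₂(ℚ̄_ℓ)`, `ψ` a continuous character), the Satake
parameters of `π` are, at almost every place, a sum of Satake parameters of `k ≥ 2` cuspidal
automorphic representations of smaller `GL_{m_i}(𝔸_ℚ)` — which the in-tree isobaric rigidity
theorem `CuspidalAutomorphicRepData.not_eventually_satake_eq_sum_of_JS` forbids. -/
def TensorCellIsobaricOverQ : Prop :=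
  ∀ (hcpt : isCompact_glFiniteIntegralLevel 7 ℚ) (π : CuspidalAutomorphicRepData 7 ℚ hcpt)
    (T : InfinityType ℚ 7), π.1.HasInfinityType T → T.IsRegular → T.IsLAlgebraic →
    (∃ (h1 : isCompact_glFiniteIntegralLevel 1 ℚ) (η : CuspidalAutomorphicRepData 1 ℚ h1),
      ∀ᶠ v : HeightOneSpectrum (𝓞 ℚ) in Filter.cofinite, ∀ α : Multiset ℂ,
        π.1.HasSatakeParamAt v α →
          ∃ e : ℂ, η.1.HasSatakeParamAt v {e} ∧ α.map (fun a => a⁻¹) = α.map (fun a => e * a)) →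
    ∃ S : Finset ℕ, ∀ (ℓ : ℕ) [Fact ℓ.Prime], ℓ ∉ S → ∀ (ι : PadicAlgCl ℓ ≃+* ℂ)
      (ρ : FramedGaloisRep ℚ (PadicAlgCl ℓ) 7),
      (∀ᶠ v : HeightOneSpectrum (𝓞 ℚ) in Filter.cofinite,
          Summit.Langlands.SatakeFrobCompatibleAt ι π.1 ρ v) →
      ∀ (r₁ r₂ : FramedGaloisRep ℚ (PadicAlgCl ℓ) 2)
        (ψ : absoluteGaloisGroup ℚ →ₜ* (PadicAlgCl ℓ)ˣ),
        (∀ g : absoluteGaloisGroup ℚ,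
            FramedRep.charpoly ρ g =
              (Matrix.kroneckerMap (· * ·)
                  ((r₁ g : GL (Fin 2) (PadicAlgCl ℓ)) : Matrix (Fin 2) (Fin 2) (PadicAlgCl ℓ))
                  ((r₂ g : GL (Fin 2) (PadicAlgCl ℓ)) : Matrix (Fin 2) (Fin 2) (PadicAlgCl ℓ))).charpoly *
                FramedRep.charpoly (FramedRep.adZeroTwoTwist r₂ ψ) g) →
        ∃ (k : ℕ) (m : Fin k → ℕ) (hm : ∀ i, isCompact_glFiniteIntegralLevel (m i) ℚ)
          (σ : ∀ i, CuspidalAutomorphicRepData (m i) ℚ (hm i)),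
          2 ≤ k ∧ (∀ i, 0 < m i) ∧
            ∀ᶠ v : HeightOneSpectrum (𝓞 ℚ) in Filter.cofinite, ∀ α : Multiset ℂ,
              π.1.HasSatakeParamAt v α →
                ∃ β : Fin k → Multiset ℂ, (∀ i, (σ i).1.HasSatakeParamAt v (β i)) ∧ α = ∑ i, β i

/-- First lemma of card `double-extension-g2-place` ("two compatible sub-systems vs one
irreducible place").  If `π` (cuspidal on `GL₇/ℚ`) has an IRREDUCIBLE Satake–Frobenius compatible
framed avatar at some `(ℓ₀, ι₀)` (in the G₂ branch: the place of Lie type `G₂`), then at no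
`(ℓ, ι)` can a compatible framed avatar `ρ` have the Frobenius-wise characteristic polynomials of
`𝓡₄ ℓ ι ⊕ 𝓡₃ ℓ ι` for two weakly compatible systems `𝓡₄` (rank 4) and `𝓡₃` (rank 3) of `Γ_ℚ`:
otherwise `Q₄ · Q₃ = ` Satake polynomial of `π` almost everywhere, so at `(ℓ₀, ι₀)` Chebotarev and
Brauer–Nesbitt give `r₀ ≃ (𝓡₄ ℓ₀ ι₀ ⊕ 𝓡₃ ℓ₀ ι₀)^ss`, reducible. Pure compatible-systems
bookkeeping (M). -/
def TwoSystemsVsIrreduciblePlace : Prop :=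
  ∀ (hcpt : isCompact_glFiniteIntegralLevel 7 ℚ) (π : CuspidalAutomorphicRepData 7 ℚ hcpt),
    (∃ (ℓ₀ : ℕ) (_ : Fact ℓ₀.Prime) (ι₀ : PadicAlgCl ℓ₀ ≃+* ℂ)
        (r₀ : FramedGaloisRep ℚ (PadicAlgCl ℓ₀) 7),
        (∀ᶠ v : HeightOneSpectrum (𝓞 ℚ) in Filter.cofinite,
            Summit.Langlands.SatakeFrobCompatibleAt ι₀ π.1 r₀ v) ∧
          r₀.toGaloisRep.IsIrreducible) →
    ∀ (ℓ : ℕ) [Fact ℓ.Prime] (ι : PadicAlgCl ℓ ≃+* ℂ) (ρ : FramedGaloisRep ℚ (PadicAlgCl ℓ) 7),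
      (∀ᶠ v : HeightOneSpectrum (𝓞 ℚ) in Filter.cofinite,
          Summit.Langlands.SatakeFrobCompatibleAt ι π.1 ρ v) →
      ∀ (S₄ : Finset (HeightOneSpectrum (𝓞 ℚ))) (Q₄ : HeightOneSpectrum (𝓞 ℚ) → Polynomial ℂ)
        (H₄ : Multiset ℤ)
        (𝓡₄ : ∀ (l : ℕ) [Fact l.Prime], (PadicAlgCl l ≃+* ℂ) → FramedGaloisRep ℚ (PadicAlgCl l) 4)
        (S₃ : Finset (HeightOneSpectrum (𝓞 ℚ))) (Q₃ : HeightOneSpectrum (𝓞 ℚ) → Polynomial ℂ)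
        (H₃ : Multiset ℤ)
        (𝓡₃ : ∀ (l : ℕ) [Fact l.Prime], (PadicAlgCl l ≃+* ℂ) → FramedGaloisRep ℚ (PadicAlgCl l) 3),
        IsWeaklyCompatibleSystemRat 4 S₄ Q₄ H₄ 𝓡₄ →
        IsWeaklyCompatibleSystemRat 3 S₃ Q₃ H₃ 𝓡₃ →
        (∀ g : absoluteGaloisGroup ℚ,
            FramedRep.charpoly ρ g =
              FramedRep.charpoly (𝓡₄ ℓ ι) g * FramedRep.charpoly (𝓡₃ ℓ ι) g) →
        False

/-- Sanity: the conclusion shape of `TensorCellIsobaricOverQ` is literally the negated hypothesis of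
the in-tree isobaric rigidity theorem, so the card's clash is one `exact` away (given the two JS
named facts). -/
example (hJSb : JacquetShalika1981_partialPairL_boundary_repData)
    (hJSp : JacquetShalika1981_partialPairL_pole_repData)
    {hcpt : isCompact_glFiniteIntegralLevel 7 ℚ} (π : CuspidalAutomorphicRepData 7 ℚ hcpt)
    {k : ℕ} {m : Fin k → ℕ} {hm : ∀ i, isCompact_glFiniteIntegralLevel (m i) ℚ}
    (σ : ∀ i, CuspidalAutomorphicRepData (m i) ℚ (hm i)) (hk : 2 ≤ k) (hm0 : ∀ i, 0 < m i)
    (H : ∀ᶠ v : HeightOneSpectrum (𝓞 ℚ) in Filter.cofinite, ∀ α : Multiset ℂ,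
      π.1.HasSatakeParamAt v α →
        ∃ β : Fin k → Multiset ℂ, (∀ i, (σ i).1.HasSatakeParamAt v (β i)) ∧ α = ∑ i, β i) :
    False :=
  CuspidalAutomorphicRepData.not_eventually_satake_eq_sum_of_JS hJSb hJSp π σ (by norm_num) hk hm0 H

end Summit.Langlands.Langlands.Cruxes.LineOrIrreducibleAdmissible.Ideas
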